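import Mathlib.MeasureTheory.Measure.Prod
import Mathlib.MeasureTheory.Integral.Bochner.Basic
import Mathlib.MeasureTheory.Integral.IntegrableOn
import Mathlib.MeasureTheory.Measure.Real

/-!
# The slot-shift identity (abstract Fubini form)

Helper file for the crux `QuadrupoleSelectionRule` (stmt-CriticalPhenomena-7029, informal) of route
`CardyFlipRusso` (sub-problem `CardyFormulaZ2`), line `Sketch`, generation 2 (the transfer chain
of card `average-first-odd-sector-gap`), stub T1.

Inside randomness `μ` (environment and colours inside a mesoscopic disc) and outside randomness
`ν` are independent, so the annealed law is the product `μ ⊗ ν`.  The four-arm arc event attached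
to a quadrilateral reads `{(x, y) | (ϑ x, y) ∈ A}`: the inside configuration `x` enters only
through its ARRIVAL DATA `ϑ x` (the landing structure of the four interfaces on the circle), and
`A ⊆ Θ × Y` says that the outside completes the data to the required arc pattern.  The role shift
`σ : Θ → Θ` of the four slots turns `E_AC` into (the colour-flipped) `E_BD`.  The identity proved
here,

`(μ ⊗ ν){(σ (ϑ x), y) ∈ A} − (μ ⊗ ν){(ϑ x, y) ∈ A} = ∫ (f (σ θ) − f θ) d(ϑ_* μ)(θ)`,
`f θ = ν {y | (θ, y) ∈ A}`,

is the slot-shift identity `Δ_Q = ⟨σ_* ν_Q − ν_Q, f⟩` of the card: the flip response is the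
pairing of the (role-shifted minus original) arrival law with the far-field completion functional.
Pure measure theory (Tonelli on the product, change of variables along `ϑ`).
-/

noncomputable section

open MeasureTheory Set

namespace Summit.CriticalPhenomena.CardyFormulaZ2.Theorems

variable {X Y Θ : Type*} [MeasurableSpace X] [MeasurableSpace Y] [MeasurableSpace Θ]

/-- The section functional `θ ↦ ν {y | (θ, y) ∈ A}` (as a real number) is measurable for a
measurable `A ⊆ Θ × Y` and an s-finite `ν`. [folklore] -/
theorem measurable_real_sectionMeasure (ν : Measure Y) [SFinite ν] {A : Set (Θ × Y)}
    (hA : MeasurableSet A) : Measurable fun θ => ν.real {y | (θ, y) ∈ A} :=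
  (measurable_measure_prodMk_left hA).ennreal_toReal

/-- **Tonelli for an arc event read through arrival data.** For a measurable `τ : X → Θ` and a
measurable `A ⊆ Θ × Y`, the product probability of `{(x, y) | (τ x, y) ∈ A}` is the `μ`-integral
of the outside completion probability `ν {y | (τ x, y) ∈ A}`. [folklore] -/
theorem prod_real_setOf_comp_eq_integral (μ : Measure X) (ν : Measure Y) [SFinite μ]
    [IsFiniteMeasure ν] {τ : X → Θ} (hτ : Measurable τ) {A : Set (Θ × Y)}
    (hA : MeasurableSet A) :
    (μ.prod ν).real {p : X × Y | (τ p.1, p.2) ∈ A} = ∫ x, ν.real {y | (τ x, y) ∈ A} ∂μ := by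
  -- the event is the preimage of `A` under the measurable map `(x, y) ↦ (τ x, y)`
  have hS : MeasurableSet {p : X × Y | (τ p.1, p.2) ∈ A} :=
    ((hτ.comp measurable_fst).prodMk measurable_snd) hA
  rw [measureReal_def, Measure.prod_apply hS]
  -- sections of the event
  have hsec : ∀ x : X, Prod.mk x ⁻¹' {p : X × Y | (τ p.1, p.2) ∈ A} = {y | (τ x, y) ∈ A} := by
    intro x; ext y; simp
  simp_rw [hsec]
  rw [← integral_toReal]
  · rfl
  · exact ((measurable_measure_prodMk_left hA).comp hτ).aemeasurable
  · exact Filter.Eventually.of_forall fun x => measure_lt_top ν _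

/-- **The slot-shift identity (stub T1 of line `Sketch`, generation 2).**  With inside law `μ`,
outside law `ν` (independent), arrival data `ϑ`, role shift `σ` and arc-completion relation `A`:
the difference of the annealed probabilities of the role-shifted and the original arc events is the
integral of `f ∘ σ − f` against the arrival law `ϑ_* μ`, where `f θ = ν {y | (θ, y) ∈ A}`.
This is `Δ_Q = ⟨σ_* ν_Q − ν_Q, f⟩` of card `average-first-odd-sector-gap`. [folklore] -/
theorem prod_real_shift_sub_eq_integral_map (μ : Measure X) (ν : Measure Y)
    [IsProbabilityMeasure μ] [IsProbabilityMeasure ν] (ϑ : X → Θ) (hϑ : Measurable ϑ)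
    (σ : Θ → Θ) (hσ : Measurable σ) (A : Set (Θ × Y)) (hA : MeasurableSet A) :
    (μ.prod ν).real {p | (σ (ϑ p.1), p.2) ∈ A} - (μ.prod ν).real {p | (ϑ p.1, p.2) ∈ A} =
      ∫ θ, (ν.real {y | (σ θ, y) ∈ A} - ν.real {y | (θ, y) ∈ A}) ∂(μ.map ϑ) := by
  -- the completion functional and its shift
  have hf : Measurable fun θ => ν.real {y | (θ, y) ∈ A} := measurable_real_sectionMeasure ν hA
  have hfσ : Measurable fun θ => ν.real {y | (σ θ, y) ∈ A} := hf.comp hσ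
  -- Tonelli for both events
  have h1 := prod_real_setOf_comp_eq_integral μ ν (hσ.comp hϑ) hA
  have h0 := prod_real_setOf_comp_eq_integral μ ν hϑ hA
  simp only [Function.comp_apply] at h1
  rw [h1, h0]
  -- change of variables along `ϑ`
  have hmap : ∫ θ, (ν.real {y | (σ θ, y) ∈ A} - ν.real {y | (θ, y) ∈ A}) ∂(μ.map ϑ) =
      ∫ x, (ν.real {y | (σ (ϑ x), y) ∈ A} - ν.real {y | (ϑ x, y) ∈ A}) ∂μ :=
    integral_map hϑ.aemeasurable (hfσ.sub hf).aestronglyMeasurable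
  rw [hmap]
  -- both integrands are bounded by `1`, hence integrable, and the integral splits
  have hint : ∀ {g : X → ℝ}, Measurable g → (∀ x, |g x| ≤ 1) → Integrable g μ := by
    intro g hg hb
    exact Integrable.of_bound hg.aestronglyMeasurable 1
      (Filter.Eventually.of_forall fun x => by simpa [Real.norm_eq_abs] using hb x)
  have hb : ∀ (θ : Θ), |ν.real {y | (θ, y) ∈ A}| ≤ 1 := fun θ => by
    rw [abs_of_nonneg measureReal_nonneg]; exact measureReal_le_one
  have I1 : Integrable (fun x => ν.real {y | (σ (ϑ x), y) ∈ A}) μ :=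
    hint (g := fun x => ν.real {y | (σ (ϑ x), y) ∈ A}) (hfσ.comp hϑ) fun x => hb _
  have I0 : Integrable (fun x => ν.real {y | (ϑ x, y) ∈ A}) μ :=
    hint (g := fun x => ν.real {y | (ϑ x, y) ∈ A}) (hf.comp hϑ) fun x => hb _
  exact (integral_sub I1 I0).symm

end Summit.CriticalPhenomena.CardyFormulaZ2.Theorems

end
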